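import Summits.QuantumFields.BalabanUV.Beta.RelInvCombShiftedSpread
import Summits.QuantumFields.BalabanUV.Beta.RelInvBorderedHessian
import Summits.QuantumFields.BalabanUV.Beta.CombChartStepJets

/-!
# `BalabanUV.Beta.D1BFx.ChartDefectResolvent` — road «BF-x» for binder row D1, junction (J1): **THE CHART-DEFECT FORMULA** —
# two relative inverses w.r.t. THE SAME slice projector `E` of two bordered operators `𝕄` and `𝕄′ = 𝕄 + c • D` differ by ONE insertion of `D`:
# `A′ = A − c • A∘D∘A′ = A − c • A′∘D∘A`, and only the slice-compressed legs `E∘D∘E` enter (`A∘D∘A′ = A∘(E∘D∘E)∘A′`).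
# INSTANCE (blocking `Lc`, level `0`, centred root `ρ_c = toSite (ctrOff (d+1) Lc) = ctr (d+1) Lc`): the (III′) literal's one-step resolvent
# `CombChartStepJets.GcombSh Lc 0 = coDressKAt ρ_c Lc (Gsym Lc 0)` (an2's P2 `RelInvCombShiftedSpread.relInv_coDressKAt_Gsym_bhKStepSh`: relative inverse of the
# LEGGED border `bhKStepSh d Lc (Dsh Lc) 0 = bhK Lc + Dsh Lc`) and the road's kernel `G₀^{bm} ρ_c = coDressKBmAt ρ_c Lc (KInvStep Lc 0)`
# (`BorderedHessian.relInv_coDressKBmAt_KInvStep_zero`: relative inverse of the STRAIGHT border `bhK Lc`), both on `axEc ρ_c Lc`, satisfy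
#   `GcombSh Lc 0 = G₀^{bm} ρ_c − G₀^{bm} ρ_c ∘ Dsh Lc ∘ GcombSh Lc 0 = G₀^{bm} ρ_c − GcombSh Lc 0 ∘ Dsh Lc ∘ G₀^{bm} ρ_c`
# — the kernel-level content of the road's (J1) «ONE ROW» (PART 22 `RoadEndBFxRoadScalesJ1RowS`'s `hC₁`) when the END is pinned at the road's native literal
# (`FirstStepPinned.JcPin`, root `ctrOff`): the two charts differ EXACTLY by words with one legged-border insertion `Dsh = ±dz∘lam04` (`DshAn1.Dsh`),
# i.e. by `axEc∘Dsh∘axEc ≠ 0` (R-D1-g35-1 §1).  Located finding F-g22-1 (journal l.47621, `HOME/b2b-balaban-beta-d1-p2/PART23-FINDING-g22.md`).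

HONEST DEPENDENCY (cell records, verbatim): «continuum YM on T⁴ ⇐ BetaPertH ∧ nine spine estimates (0/9 proved); BetaPertH ⇐ (D1) ∧ (D4) ∧
CAP+tail; G-an2-4 gates asym, D1 and NE2/3/4.»  HONEST FRAMING (cell contract, verbatim): «discharging `BetaPertH` makes Bałaban's UV stability
UNCONDITIONAL — a real constructive-QFT result; it is NOT the continuum limit and NOT the Clay problem.»  THIS MODULE DISCHARGES NOTHING of (J1),
of (K), of D1 or of the wall: [folklore] four-rule algebra of relative inverses (`ChartConjugationRelative.RelInv`) in the tame kernel calculus, composed BY NAME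
with two landed relative-inverse sockets.  No definition, no `def … : Prop`, nothing cited, 0 sorry.  0 root-level binders of row D1 discharged; (J1) OPEN;
(K) NOT closed; NOT D1, NOT `BetaPertH`, NOT continuum, NOT Clay.

ABSOLUTE RULE (cell charter, verbatim): «No internally-minted statement may enter as a cited fact. Every hypothesis is either kernel-proved in this
package or a verbatim quotation of a PUBLISHED theorem with page reference. The manuscript(s) under audit are NOT citable for their own disputed
steps — they are the thing under adjudication; programme-internal (2001/route/tribunal) claims are never citable.»

CONTENT (all [folklore]):
* §1 generic: `comp_comp_relInv_left` (`A∘𝕄∘A′ = A′`), `comp_comp_relInv_right` (`A∘𝕄′∘A′ = A`), `relInv_eq_add_defect` ∕ `relInv_eq_sub_defect`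
  (`A = A′ + c • A∘D∘A′`, `A′ = A − c • A∘D∘A′`), the mirror forms `…_defect'`, and `comp_comp_eq_sandwich` (`A∘D∘A′ = A∘(E∘D∘E)∘A′`).
* §2 instance at level `0`: `relInv_G0bm_ctr`, `relInv_GcombSh_zero`, `G0bm_eq_GcombSh_zero_add_defect(')`, `GcombSh_zero_eq_sub_defect(')`,
  `G0bm_sub_GcombSh_zero_eq`, `GcombSh_zero_defect_sandwich`.
Unit `b2b-balaban-beta-d1-p2` (road owner, gen 22), 2026-08-22.
-/

noncomputable section

namespace Summit.QuantumFields.BalabanUV.Beta.D1BFx.ChartDefectResolvent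

open Literature.MathematicalPhysics.QuantumFieldTheory.Balaban1983to89
open Literature.MathematicalPhysics.QuantumFieldTheory.Balaban1983to89.Beta
open ExpKernelCalculus (MKer Decays comp)
open OneStepResolventKernel (Fib)
open OneStepKernelFamily (KInvStep)
open AffineAveraging (box toSite)
open AveragingContoursRooted (ctr ctrOff ctrOff_mem_box)
open Summit.QuantumFields.BalabanUV.Beta.TameKernelCalculus
open Summit.QuantumFields.BalabanUV.Beta.ChartConjugationRelative (RelInv spr_comp)
open Summit.QuantumFields.BalabanUV.Beta.AxialDressingRooted (coDressKBmAt spr_coDressKBmAt one_le_of_neZero axEc spr_axEc)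
open Summit.QuantumFields.BalabanUV.Beta.SymmetrisedStepJets (Gsym)
open Summit.QuantumFields.BalabanUV.Beta.CombChartStepJets (GcombSh)
open Summit.QuantumFields.BalabanUV.Beta.SymShiftedSpread (bhKStepSh bhKStepSh_apply)
open Summit.QuantumFields.BalabanUV.Beta.DshAn1 (Dsh spr_Dsh)
open Summit.QuantumFields.BalabanUV.Beta.BorderedHessian (bhK spr_bhK bhKStep_zero relInv_coDressKBmAt_KInvStep_zero spr_KInvStep)
open Summit.QuantumFields.BalabanUV.Beta.RelInvCombShiftedSpread (relInv_coDressKAt_Gsym_bhKStepSh)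
open Summit.QuantumFields.BalabanUV.Beta.CombChartResolventRules (spr_coDressKAt_Gsym)

/-! ## §1 Two relative inverses on one slice: the defect formula -/

section Generic

variable {D : ℕ} {F : Type*} [Fintype F]

/-- [folklore] **`A∘𝕄∘A′ = A′`** for `RelInv A 𝕄 E` and any `A′` living on the slice from the left (`E∘A′ = A′`):
`A∘𝕄∘A′ = (A∘𝕄)∘(E∘A′) = ((A∘𝕄)∘E)∘A′ = E∘A′ = A′`. -/
theorem comp_comp_relInv_left {A M E A' : MKer D F} (hA : Spr A) (hM : Spr M) (hE : Spr E) (hA' : Spr A') (hR : RelInv A M E)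
    (hEA' : comp E A' = A') : comp (comp A M) A' = A' := by
  calc comp (comp A M) A' = comp (comp A M) (comp E A') := by rw [hEA']
    _ = comp (comp (comp A M) E) A' := comp_assoc_tame (spr_comp hA hM).tame hE.tame hA'.tame
    _ = comp E A' := by rw [hR.AME]
    _ = A' := hEA'

/-- [folklore] **`A∘𝕄′∘A′ = A`** for `RelInv A′ 𝕄′ E` and any `A` living on the slice from the right (`A∘E = A`):
`A∘𝕄′∘A′ = ((A∘E)∘𝕄′)∘A′ = (A∘(E∘𝕄′))∘A′ = A∘((E∘𝕄′)∘A′) = A∘E = A`. -/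
theorem comp_comp_relInv_right {A M' E A' : MKer D F} (hA : Spr A) (hM' : Spr M') (hE : Spr E) (hA' : Spr A') (hR' : RelInv A' M' E)
    (hAE : comp A E = A) : comp (comp A M') A' = A := by
  calc comp (comp A M') A' = comp (comp (comp A E) M') A' := by rw [hAE]
    _ = comp (comp A (comp E M')) A' := by rw [comp_assoc_tame hA.tame hE.tame hM'.tame]
    _ = comp A (comp (comp E M') A') := (comp_assoc_tame hA.tame (spr_comp hE hM').tame hA'.tame).symm
    _ = comp A E := by rw [hR'.EMA]
    _ = A := hAE

/-- [folklore] **THE DEFECT FORMULA (additive form)**: if `RelInv A 𝕄 E` and `RelInv A′ (𝕄 + c • D) E` (all kernels spread) then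
`A = A′ + c • A∘D∘A′` — subtract `A∘𝕄∘A′ = A′` from `A∘(𝕄 + c•D)∘A′ = A`. -/
theorem relInv_eq_add_defect {A M E A' D' : MKer D F} (hA : Spr A) (hM : Spr M) (hE : Spr E) (hA' : Spr A') (hD : Spr D')
    (hR : RelInv A M E) (c : ℝ) (hR' : RelInv A' (M + c • D') E) : A = A' + c • comp (comp A D') A' := by
  have hM' : Spr (M + c • D') := RelInvNullShift.spr_add hM (RelInvNullShift.spr_smul c hD)
  have h1 : comp (comp A (M + c • D')) A' = A := comp_comp_relInv_right hA hM' hE hA' hR' hR.AE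
  have h2 : comp (comp A M) A' = A' := comp_comp_relInv_left hA hM hE hA' hR hR'.EA
  have h3 : comp (comp A (M + c • D')) A' = comp (comp A M) A' + c • comp (comp A D') A' := by
    rw [comp_add_right_tame hA.tame hM.tame (RelInvNullShift.spr_smul c hD).tame, KernelReflection.comp_smul_right,
      comp_add_left_tame (spr_comp hA hM).tame (RelInvNullShift.spr_smul c (spr_comp hA hD)).tame hA'.tame, KernelReflection.comp_smul_left]
  rw [h3, h2] at h1
  exact h1.symm

/-- [folklore] **THE DEFECT FORMULA (resolvent form)**: `A′ = A − c • A∘D∘A′`. -/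
theorem relInv_eq_sub_defect {A M E A' D' : MKer D F} (hA : Spr A) (hM : Spr M) (hE : Spr E) (hA' : Spr A') (hD : Spr D')
    (hR : RelInv A M E) (c : ℝ) (hR' : RelInv A' (M + c • D') E) : A' = A - c • comp (comp A D') A' :=
  eq_sub_iff_add_eq.mpr (relInv_eq_add_defect hA hM hE hA' hD hR c hR').symm

/-- [folklore] **THE MIRROR DEFECT FORMULA (additive form)**: `A = A′ + c • A′∘D∘A` — the two cross rules with the roles exchanged:
`A′∘(𝕄 + c•D)∘A = A` (`comp_comp_relInv_left` at `(A′, 𝕄 + c•D)`) and `A′∘𝕄∘A = A′` (`comp_comp_relInv_right` at `(A, 𝕄)`). -/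
theorem relInv_eq_add_defect' {A M E A' D' : MKer D F} (hA : Spr A) (hM : Spr M) (hE : Spr E) (hA' : Spr A') (hD : Spr D')
    (hR : RelInv A M E) (c : ℝ) (hR' : RelInv A' (M + c • D') E) : A = A' + c • comp (comp A' D') A := by
  have hM' : Spr (M + c • D') := RelInvNullShift.spr_add hM (RelInvNullShift.spr_smul c hD)
  have h1 : comp (comp A' (M + c • D')) A = A := comp_comp_relInv_left hA' hM' hE hA hR' hR.EA
  have h2 : comp (comp A' M) A = A' := comp_comp_relInv_right hA' hM hE hA hR hR'.AE
  have h3 : comp (comp A' (M + c • D')) A = comp (comp A' M) A + c • comp (comp A' D') A := by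
    rw [comp_add_right_tame hA'.tame hM.tame (RelInvNullShift.spr_smul c hD).tame, KernelReflection.comp_smul_right,
      comp_add_left_tame (spr_comp hA' hM).tame (RelInvNullShift.spr_smul c (spr_comp hA' hD)).tame hA.tame, KernelReflection.comp_smul_left]
  rw [h3, h2] at h1
  exact h1.symm

/-- [folklore] **THE MIRROR DEFECT FORMULA (resolvent form)**: `A′ = A − c • A′∘D∘A`. -/
theorem relInv_eq_sub_defect' {A M E A' D' : MKer D F} (hA : Spr A) (hM : Spr M) (hE : Spr E) (hA' : Spr A') (hD : Spr D')
    (hR : RelInv A M E) (c : ℝ) (hR' : RelInv A' (M + c • D') E) : A' = A - c • comp (comp A' D') A :=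
  eq_sub_iff_add_eq.mpr (relInv_eq_add_defect' hA hM hE hA' hD hR c hR').symm

/-- [folklore] **ONLY THE SLICE-COMPRESSED LEGS ENTER**: `A∘D∘A′ = A∘(E∘D∘E)∘A′` whenever `A∘E = A` and `E∘A′ = A′` — so the defect vanishes iff
nothing but the sandwich-null part of `D` is seen (`RelInvNullShift.relInv_add_of_sandwich_null` is the case `E∘D∘E = 0`). -/
theorem comp_comp_eq_sandwich {A E A' D' : MKer D F} (hA : Spr A) (hE : Spr E) (hA' : Spr A') (hD : Spr D')
    (hAE : comp A E = A) (hEA' : comp E A' = A') : comp (comp A D') A' = comp (comp A (comp (comp E D') E)) A' := by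
  calc comp (comp A D') A' = comp (comp (comp A E) D') (comp E A') := by rw [hAE, hEA']
    _ = comp (comp A (comp E D')) (comp E A') := by rw [comp_assoc_tame hA.tame hE.tame hD.tame]
    _ = comp (comp (comp A (comp E D')) E) A' := comp_assoc_tame (spr_comp hA (spr_comp hE hD)).tame hE.tame hA'.tame
    _ = comp (comp A (comp (comp E D') E)) A' := by rw [comp_assoc_tame hA.tame (spr_comp hE hD).tame hE.tame]

end Generic

/-! ## §2 The instance: the (III′) literal's resolvent against the road's kernel at the centred root, level `0` -/

section Instance

variable {d : ℕ} {Lc : ℕ} [NeZero Lc]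

omit [NeZero Lc] in
/-- [folklore] The centred root IS `toSite` of the centred offset (`AveragingContoursRooted.ctr` is that by definition) — so `G₀^{bm} ρ_c` below is
LITERALLY the road's kernel `coDressKBmAt (toSite (r n)) n (KInvStep n 0)` at `r n := ctrOff (d+1) n` (PART 20∕21∕22's root pin). -/
theorem ctr_eq_toSite_ctrOff : ctr (d + 1) Lc = toSite (ctrOff (d + 1) Lc) := rfl

/-- [folklore] The road's kernel at the centred root is the relative inverse of the STRAIGHT border on the centred comb slice
(`BorderedHessian.relInv_coDressKBmAt_KInvStep_zero` at `r := ctrOff (d+1) Lc`). -/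
theorem relInv_G0bm_ctr :
    RelInv (coDressKBmAt (ctr (d + 1) Lc) Lc (KInvStep (d := d) Lc 0)) (bhK Lc) (axEc (ctr (d + 1) Lc) Lc) :=
  relInv_coDressKBmAt_KInvStep_zero (ctrOff_mem_box (one_le_of_neZero Lc))

/-- [folklore] The (III′) literal's level-`0` resolvent is the relative inverse of the LEGGED border `bhK + 1 • Dsh` on the same slice (an2's P2 at `j = 0`,
`bhKStep d Lc 0 = bhK Lc`, `stepScale d Lc 0 = 1`). -/
theorem relInv_GcombSh_zero :
    RelInv (GcombSh (d := d) Lc 0) (bhK Lc + (1 : ℝ) • Dsh Lc) (axEc (ctr (d + 1) Lc) Lc) := by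
  have h := relInv_coDressKAt_Gsym_bhKStepSh (d := d) (Lc := Lc) 0
  rw [bhKStepSh_apply, bhKStep_zero] at h
  have hs : BorderedHessian.stepScale d Lc 0 = 1 := by simp [BorderedHessian.stepScale]
  rw [hs] at h
  exact h

/-- [folklore] The road's kernel at the centred root is spread. -/
theorem spr_G0bm_ctr : Spr (coDressKBmAt (ctr (d + 1) Lc) Lc (KInvStep (d := d) Lc 0)) :=
  spr_coDressKBmAt (one_le_of_neZero Lc) (ctrOff_mem_box (one_le_of_neZero Lc)) (spr_KInvStep (d := d) (Lc := Lc) 0)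

/-- [folklore] The (III′) resolvent is spread (`CombChartResolventRules.spr_coDressKAt_Gsym`). -/
theorem spr_GcombSh_zero : Spr (GcombSh (d := d) Lc 0) := spr_coDressKAt_Gsym (d := d) (Lc := Lc) 0

/-- [folklore] **THE CHART-DEFECT FORMULA, level `0` (additive form)**: `G₀^{bm} ρ_c = GcombSh Lc 0 + G₀^{bm} ρ_c ∘ Dsh Lc ∘ GcombSh Lc 0`. -/
theorem G0bm_eq_GcombSh_zero_add_defect :
    coDressKBmAt (ctr (d + 1) Lc) Lc (KInvStep (d := d) Lc 0)
      = GcombSh (d := d) Lc 0 + comp (comp (coDressKBmAt (ctr (d + 1) Lc) Lc (KInvStep (d := d) Lc 0)) (Dsh Lc)) (GcombSh (d := d) Lc 0) := by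
  have hL : 1 ≤ Lc := one_le_of_neZero Lc
  have h := relInv_eq_add_defect spr_G0bm_ctr (spr_bhK hL) (spr_axEc _ _) spr_GcombSh_zero (spr_Dsh hL) relInv_G0bm_ctr 1
    (relInv_GcombSh_zero (d := d) (Lc := Lc))
  rw [one_smul] at h
  exact h

/-- [folklore] **THE MIRROR CHART-DEFECT FORMULA, level `0` (additive form)**: `G₀^{bm} ρ_c = GcombSh Lc 0 + GcombSh Lc 0 ∘ Dsh Lc ∘ G₀^{bm} ρ_c`. -/
theorem G0bm_eq_GcombSh_zero_add_defect' :
    coDressKBmAt (ctr (d + 1) Lc) Lc (KInvStep (d := d) Lc 0)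
      = GcombSh (d := d) Lc 0 + comp (comp (GcombSh (d := d) Lc 0) (Dsh Lc)) (coDressKBmAt (ctr (d + 1) Lc) Lc (KInvStep (d := d) Lc 0)) := by
  have hL : 1 ≤ Lc := one_le_of_neZero Lc
  have h := relInv_eq_add_defect' spr_G0bm_ctr (spr_bhK hL) (spr_axEc _ _) spr_GcombSh_zero (spr_Dsh hL) relInv_G0bm_ctr 1
    (relInv_GcombSh_zero (d := d) (Lc := Lc))
  rw [one_smul] at h
  exact h

/-- [folklore] **THE CHART-DEFECT FORMULA, level `0` (resolvent form)**: `GcombSh Lc 0 = G₀^{bm} ρ_c − G₀^{bm} ρ_c ∘ Dsh Lc ∘ GcombSh Lc 0`. -/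
theorem GcombSh_zero_eq_sub_defect :
    GcombSh (d := d) Lc 0 = coDressKBmAt (ctr (d + 1) Lc) Lc (KInvStep (d := d) Lc 0)
      - comp (comp (coDressKBmAt (ctr (d + 1) Lc) Lc (KInvStep (d := d) Lc 0)) (Dsh Lc)) (GcombSh (d := d) Lc 0) :=
  eq_sub_iff_add_eq.mpr (G0bm_eq_GcombSh_zero_add_defect (d := d) (Lc := Lc)).symm

/-- [folklore] **THE MIRROR CHART-DEFECT FORMULA, level `0` (resolvent form)**: `GcombSh Lc 0 = G₀^{bm} ρ_c − GcombSh Lc 0 ∘ Dsh Lc ∘ G₀^{bm} ρ_c`. -/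
theorem GcombSh_zero_eq_sub_defect' :
    GcombSh (d := d) Lc 0 = coDressKBmAt (ctr (d + 1) Lc) Lc (KInvStep (d := d) Lc 0)
      - comp (comp (GcombSh (d := d) Lc 0) (Dsh Lc)) (coDressKBmAt (ctr (d + 1) Lc) Lc (KInvStep (d := d) Lc 0)) :=
  eq_sub_iff_add_eq.mpr (G0bm_eq_GcombSh_zero_add_defect' (d := d) (Lc := Lc)).symm

/-- [folklore] **THE DIFFERENCE OF THE TWO CHARTS' KERNELS IS ONE LEGGED-BORDER INSERTION**: `G₀^{bm} ρ_c − GcombSh Lc 0 = G₀^{bm} ρ_c ∘ Dsh Lc ∘ GcombSh Lc 0`. -/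
theorem G0bm_sub_GcombSh_zero_eq :
    coDressKBmAt (ctr (d + 1) Lc) Lc (KInvStep (d := d) Lc 0) - GcombSh (d := d) Lc 0
      = comp (comp (coDressKBmAt (ctr (d + 1) Lc) Lc (KInvStep (d := d) Lc 0)) (Dsh Lc)) (GcombSh (d := d) Lc 0) :=
  sub_eq_iff_eq_add'.mpr (G0bm_eq_GcombSh_zero_add_defect (d := d) (Lc := Lc))

/-- [folklore] **ONLY `axEc∘Dsh∘axEc` IS SEEN** (the located non-null object of R-D1-g35-1 §1):
`G₀^{bm} ρ_c ∘ Dsh Lc ∘ GcombSh Lc 0 = G₀^{bm} ρ_c ∘ (axEc ρ_c ∘ Dsh Lc ∘ axEc ρ_c) ∘ GcombSh Lc 0`. -/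
theorem GcombSh_zero_defect_sandwich :
    comp (comp (coDressKBmAt (ctr (d + 1) Lc) Lc (KInvStep (d := d) Lc 0)) (Dsh Lc)) (GcombSh (d := d) Lc 0)
      = comp (comp (coDressKBmAt (ctr (d + 1) Lc) Lc (KInvStep (d := d) Lc 0)) (comp (comp (axEc (ctr (d + 1) Lc) Lc) (Dsh Lc)) (axEc (ctr (d + 1) Lc) Lc)))
          (GcombSh (d := d) Lc 0) :=
  comp_comp_eq_sandwich spr_G0bm_ctr (spr_axEc _ _) spr_GcombSh_zero (spr_Dsh (one_le_of_neZero Lc)) relInv_G0bm_ctr.AE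
    (relInv_GcombSh_zero (d := d) (Lc := Lc)).EA

end Instance

end Summit.QuantumFields.BalabanUV.Beta.D1BFx.ChartDefectResolvent

end
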